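import Summits.RiemannHypothesis.RiemannHypothesis.Theorems.LiTailLaguerreReleased
import Summits.RiemannHypothesis.RiemannHypothesis.Theorems.LiTailMidpointDefs
import HarnessLib

/-!
# RiemannHypothesis / LiTailMidpoint — crux K1 `LiPrimeTailResonant`: the prime tail AT A RESONANT CUTOFF (RH-FREE)

RH-FREE [rh-li-eng-4 g6].  Round 8 of the LI column (theory g10; PART M `Theorems/LiTailMidpointDefs.lean`, rung leaf
«Li TAIL MIDPOINT LAW» `LiTheory.LiZeroTailMidpoint`, PROOF-OF-DATA, NOT height-buying), crux K1 of route
`Theses/LiTailMidpoint.lean`: for every `m ≥ 2` there are `N`, `C` with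
`|liPrimeTail n T − Σ_{k ∈ Ico 2 m} liCoffeyTerm k n − (Λ(m)/π) m^{−1/2} liBridgeTail n (log m) T| ≤ C log n`
for `n ≥ N`, `c_m √n ≤ T ≤ c_m √n + 1`, `c_m = liResonantScale m = (log m)^{−1/2}` (`1/c_m² = log m`: the stationary height of
`m`'s bridge term sits ON the cut).  Proof = prover g5's `PrimeTail.liPrimeTailLaguerre_bound` (round 7, K2′) with ONE change:
on `Re w = 3/2`, `π·liPrimeTail = Σ_k Λ(k) Re ∫_{Ioi T} k^{−w}(2 − k_n(w)) dy` (dominated convergence); a prime power `k < m` is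
RELEASED with gap `n/(T² + ¼) − log k ≥ ½(log m − log(m−1))` (`exists_N_resonant`) and gives `π liCoffeyTerm k n + O(Λ(k)k^{−1/2})`
(`PrimeTail.re_setIntegral_termIntegrand_released`); `k > m` is NOT released, gap `log k − n/T² ≥ log(m+1) − log m`, and gives
`O(Λ(k)k^{−3/2})` (`PrimeTail.norm_setIntegral_termIntegrand_le`); the RESONANT `k = m` is shifted to the critical line WITHOUT
evaluating its `[0, T]` piece (`setIntegral_termIntegrand_eq`, `re_setIntegral_G_half`, `norm_connector_le`; no gap needed):
`Re ∫ = m^{−1/2} liBridgeTail n (log m) T + O(m^{−1/2}(3 + e^{n/T²}))`.  Summing: error `≤ B(m) Σ_k Λ(k)k^{−3/2} ≤ C log n`.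
The statement is the route's K1 signature verbatim minus its unused hypothesis `Λ(m) ≠ 0`.  Nothing here bears on the truth of
RH (an identity-with-remainder between two explicit-formula bookkeepings); no data of record is added or changed.
-/

noncomputable section

-- D-0017: `Summit.<S>.<S>.…` is the designed namespace of a single-problem summit.
set_option linter.dupNamespace false

open Complex MeasureTheory intervalIntegral Set Filter
open scoped Real Interval Topology ArithmeticFunction.vonMangoldt

namespace Summit.RiemannHypothesis.RiemannHypothesis.Theorems.LiTheory

open Literature.NumberTheory.LFunctions

namespace PrimeTailResonant

open PrimeEdge TailContour GammaShift PrimeTail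

/-! ### The resonant scale `c_m = (log m)^{−1/2}` -/

/-- For `m ≥ 2`: `0 < log m`, `0 < c_m` and `1/c_m² = log m` (`c_m = liResonantScale m = 1/√(log m)`). -/
theorem resonantScale_facts {m : ℕ} (hm : 2 ≤ m) :
    0 < Real.log m ∧ 0 < liResonantScale m ∧ 1 / liResonantScale m ^ 2 = Real.log m := by
  have hy : 0 < Real.log m := Real.log_pos (by exact_mod_cast (show 1 < m by omega))
  refine ⟨hy, one_div_pos.2 (Real.sqrt_pos.2 hy), ?_⟩
  rw [liResonantScale, div_pow, one_pow, Real.sq_sqrt hy.le, one_div_one_div]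


/-! ### The cut separates from the released prime powers `k < m` for large `n` -/

/-- For `n ≥ N(m, δ)` and `T ≤ c_m √n + 1`: `n/(T² + ¼) ≥ log m − δ/2`, and `c_m √n ≥ 1`, `n ≥ 2`
(`c_m = liResonantScale m`, `1/c_m² = log m`; the computation of `PrimeTail.exists_N` at `c = c_m`). -/
theorem exists_N_resonant {m : ℕ} (hm : 2 ≤ m) {δ : ℝ} (hδ : 0 < δ) :
    ∃ N : ℕ, ∀ n : ℕ, N ≤ n → 2 ≤ n ∧ 1 ≤ liResonantScale m * Real.sqrt n ∧
      ∀ T : ℝ, 0 ≤ T → T ≤ liResonantScale m * Real.sqrt n + 1 → Real.log m - δ / 2 ≤ n / (T ^ 2 + 1 / 4) := by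
  obtain ⟨_, hc, hc2⟩ := resonantScale_facts hm
  rw [← hc2]
  generalize liResonantScale m = c at hc ⊢
  set A : ℝ := 2 / c + 5 / (4 * c ^ 2) with hA
  have hA0 : 0 < A := by positivity
  set K : ℝ := A * (2 / (δ * c ^ 2)) with hK
  have hK0 : 0 < K := by positivity
  refine ⟨⌈K ^ 2⌉₊ + ⌈1 / c ^ 2⌉₊ + 2, fun n hn ↦ ?_⟩
  have hn2 : 2 ≤ n := by omega
  have hnr : (⌈K ^ 2⌉₊ : ℝ) + ⌈1 / c ^ 2⌉₊ + 2 ≤ n := by exact_mod_cast hn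
  have hK2 : K ^ 2 ≤ n := (Nat.le_ceil _).trans (by linarith [Nat.cast_nonneg (α := ℝ) ⌈1 / c ^ 2⌉₊])
  have hc2n : 1 / c ^ 2 ≤ n := (Nat.le_ceil _).trans (by linarith [Nat.cast_nonneg (α := ℝ) ⌈K ^ 2⌉₊])
  have hn0 : (0 : ℝ) ≤ n := Nat.cast_nonneg n
  have hsq : Real.sqrt n ^ 2 = n := Real.sq_sqrt hn0
  have hs0 : 0 ≤ Real.sqrt n := Real.sqrt_nonneg _
  have hKs : K ≤ Real.sqrt n := Real.le_sqrt_of_sq_le hK2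
  have hs1 : 1 ≤ Real.sqrt n := by
    rw [← Real.sqrt_one]; exact Real.sqrt_le_sqrt (by norm_cast; omega)
  have hcs : 1 ≤ c * Real.sqrt n := by
    have h1 : 1 ≤ c ^ 2 * n := by
      rw [div_le_iff₀ (by positivity)] at hc2n; linarith
    have : (c * Real.sqrt n) ^ 2 = c ^ 2 * n := by rw [mul_pow, hsq]
    nlinarith [mul_nonneg hc.le hs0]
  refine ⟨hn2, hcs, fun T hT0 hT ↦ ?_⟩
  have hD : 0 < T ^ 2 + 1 / 4 := by positivity
  rw [le_div_iff₀ hD]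
  have hT2 : T ^ 2 ≤ (c * Real.sqrt n + 1) ^ 2 := pow_le_pow_left₀ hT0 hT 2
  have hkey : (2 / c) * Real.sqrt n + 5 / (4 * c ^ 2) ≤ (δ * c ^ 2 / 2) * n := by
    have h1 : (2 / c) * Real.sqrt n + 5 / (4 * c ^ 2) ≤ A * Real.sqrt n := by
      rw [hA]
      have : 5 / (4 * c ^ 2) ≤ 5 / (4 * c ^ 2) * Real.sqrt n := le_mul_of_one_le_right (by positivity) hs1
      nlinarith
    have h2 : A * Real.sqrt n ≤ (δ * c ^ 2 / 2) * (Real.sqrt n * Real.sqrt n) := by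
      have : A = (δ * c ^ 2 / 2) * K := by rw [hK]; field_simp
      rw [this, mul_assoc]
      exact mul_le_mul_of_nonneg_left (mul_le_mul_of_nonneg_right hKs hs0) (by positivity)
    rw [← pow_two, hsq] at h2
    exact h1.trans h2
  rcases le_or_gt (1 / c ^ 2 - δ / 2) 0 with hneg | hpos
  · calc (1 / c ^ 2 - δ / 2) * (T ^ 2 + 1 / 4) ≤ 0 := mul_nonpos_of_nonpos_of_nonneg hneg hD.le
      _ ≤ n := hn0
  · have hexp : (c * Real.sqrt n + 1) ^ 2 = c ^ 2 * n + 2 * c * Real.sqrt n + 1 := by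
      calc (c * Real.sqrt n + 1) ^ 2 = c ^ 2 * Real.sqrt n ^ 2 + 2 * c * Real.sqrt n + 1 := by ring
        _ = c ^ 2 * n + 2 * c * Real.sqrt n + 1 := by rw [hsq]
    have hmono : (1 / c ^ 2 - δ / 2) * (2 * c * Real.sqrt n + 5 / 4) ≤ (1 / c ^ 2) * (2 * c * Real.sqrt n + 5 / 4) :=
      mul_le_mul_of_nonneg_right (by linarith) (by positivity)
    have hcne : c ≠ 0 := hc.ne'
    calc (1 / c ^ 2 - δ / 2) * (T ^ 2 + 1 / 4) ≤ (1 / c ^ 2 - δ / 2) * ((c * Real.sqrt n + 1) ^ 2 + 1 / 4) := by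
          gcongr
      _ = n - (δ * c ^ 2 / 2) * n + (1 / c ^ 2 - δ / 2) * (2 * c * Real.sqrt n + 5 / 4) := by
          rw [hexp]
          field_simp
          ring
      _ ≤ n - (δ * c ^ 2 / 2) * n + (1 / c ^ 2) * (2 * c * Real.sqrt n + 5 / 4) := by linarith
      _ = n - (δ * c ^ 2 / 2) * n + ((2 / c) * Real.sqrt n + 5 / (4 * c ^ 2)) := by
          field_simp
      _ ≤ n := by linarith

/-! ### The resonant term: shift to the critical line, `[0, T]` piece NOT evaluated -/

/-- **The resonant prime power leaves its partial bridge above the cut.**  For `m ≥ 1`, `T ≥ 1`: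
`|Re ∫_{Ioi T} m^{−w}(2 − k_n(w)) dy − m^{−1/2} liBridgeTail n (log m) T| ≤ m^{−1/2}(3 + e^{n/T²})`
(`liBridgeTail n (log m) T = ∫_{Ioi T} 2(1 − cos nθ(t)) cos(t log m) dt`; Cauchy shift to the critical line; the only error is the
bottom connector). -/
theorem re_setIntegral_termIntegrand_resonant (n : ℕ) {m : ℕ} (hm : 0 < m) {T : ℝ} (hT : 1 ≤ T) :
    |(∫ y in Ioi T, termIntegrand n m y).re - (m : ℝ) ^ (-(1 / 2 : ℝ)) * liBridgeTail n (Real.log m) T|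
      ≤ (m : ℝ) ^ (-(1 / 2 : ℝ)) * (3 + Real.exp (n / T ^ 2)) := by
  rw [liBridgeTail]
  have hT0 : 0 < T := by linarith
  have hshift := setIntegral_termIntegrand_eq n hm hT
  set bot := ∫ x in (1 / 2 : ℝ)..(3 / 2 : ℝ), G n m (x + T * I) with hbot
  have hre : (∫ y in Ioi T, termIntegrand n m y).re =
      (m : ℝ) ^ (-(1 / 2 : ℝ)) * (∫ t in Ioi T, 2 * (1 - Real.cos (n * liZeroAngle t)) * Real.cos (t * Real.log m))
        - bot.im := by
    rw [hshift, Complex.add_re, re_setIntegral_G_half hm hT0.le, Complex.mul_re, Complex.I_re, Complex.I_im]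
    ring
  rw [hre, sub_sub_cancel_left, abs_neg]
  exact (Complex.abs_im_le_norm _).trans (norm_connector_le n hm hT0.ne')

/-! ### The crux -/

/-- **Crux K1 `LiPrimeTailResonant` of route `LiTailMidpoint`** (RH-FREE; the route decl without its unused hypothesis
`Λ(m) ≠ 0`): for `m ≥ 2` there are `N`, `C` with
`|liPrimeTail n T − Σ_{k ∈ Ico 2 m} liCoffeyTerm k n − (Λ(m)/π) m^{−1/2} liBridgeTail n (log m) T| ≤ C log n`
for `n ≥ N` and `c_m √n ≤ T ≤ c_m √n + 1`, `c_m = liResonantScale m`. -/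
theorem liPrimeTailResonant_bound (m : ℕ) (hm : 2 ≤ m) :
    ∃ N : ℕ, ∃ C : ℝ, ∀ n : ℕ, N ≤ n → ∀ T : ℝ,
      liResonantScale m * Real.sqrt n ≤ T → T ≤ liResonantScale m * Real.sqrt n + 1 →
        |liPrimeTail n T - (∑ k ∈ Finset.Ico 2 m, liCoffeyTerm k n)
            - (Λ m : ℝ) / Real.pi * (m : ℝ) ^ (-(1 / 2 : ℝ)) * liBridgeTail n (Real.log m) T|
          ≤ C * Real.log n := by
  obtain ⟨hy, hc, hc2⟩ := resonantScale_facts hm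
  set c : ℝ := liResonantScale m with hc_def
  have hm0 : 0 < m := by omega
  have hmr : (0 : ℝ) < m := by exact_mod_cast hm0
  -- the two gaps: `δ = log m − log(m − 1)` (released side), `δ₁ = log(m + 1) − log m` (non-released side)
  set δ : ℝ := Real.log m - Real.log (m - 1 : ℕ) with hδ_def
  have hδ0 : 0 < δ := by
    rw [hδ_def, sub_pos]
    rcases Nat.lt_or_ge m 3 with h3 | h3
    · obtain rfl : m = 2 := by omega
      rw [show Real.log ((2 - 1 : ℕ) : ℝ) = 0 by norm_num]; exact Real.log_pos (by norm_num)
    · exact Real.log_lt_log (by exact_mod_cast (show 0 < m - 1 by omega)) (by exact_mod_cast (show m - 1 < m by omega))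
  set δ₁ : ℝ := Real.log (m + 1 : ℕ) - Real.log m with hδ₁_def
  have hδ₁0 : 0 < δ₁ := by
    rw [hδ₁_def, sub_pos]
    exact Real.log_lt_log hmr (by exact_mod_cast (show m < m + 1 by omega))
  obtain ⟨N, hN⟩ := exists_N_resonant hm hδ0
  set E : ℝ := Real.exp (1 / c ^ 2) with hE
  set Brel : ℝ := m * (4 / Real.log 2 + 2 / (δ / 2) + 3 + E) with hBrel
  set Bres : ℝ := m * (3 + E) with hBres
  set Bnr : ℝ := 6 / Real.log 2 + 3 / (2 * c ^ 2 * Real.log 2 ^ 2) + E * (2 / δ₁ + 3 / (2 * c ^ 2 * δ₁ ^ 2)) with hBnr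
  set B : ℝ := Brel + Bres + Bnr with hB
  set f : ℕ → ℂ := fun m ↦ (Λ m : ℂ) with hf
  set S : ℝ := ∑' m : ℕ, ‖LSeries.term f (3 / 2 : ℂ) m‖ with hSdef
  have hsum := summable_norm_term
  have hl2 : 0 < Real.log 2 := Real.log_pos (by norm_num)
  have hBrel0 : 0 ≤ Brel := by positivity
  have hBres0 : 0 ≤ Bres := by positivity
  have hBnr0 : 0 ≤ Bnr := by positivity
  refine ⟨N, 1 / Real.pi * (S * B) / Real.log 2, fun n hn T hT1 hT2 ↦ ?_⟩
  obtain ⟨hn2, hcs, hgapT⟩ := hN n hn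
  have hn1 : 1 ≤ n := by omega
  have hT : 1 ≤ T := hcs.trans hT1
  have hT0 : 0 < T := by linarith
  have hnT : (n : ℝ) / T ^ 2 ≤ 1 / c ^ 2 := by
    have hsq : Real.sqrt n ^ 2 = n := Real.sq_sqrt (Nat.cast_nonneg n)
    have h1 : c ^ 2 * n ≤ T ^ 2 := by
      have := pow_le_pow_left₀ (by positivity) hT1 2
      rw [mul_pow, hsq] at this; exact this
    rw [div_le_div_iff₀ (by positivity) (by positivity)]
    linarith
  have hET : Real.exp (n / T ^ 2) ≤ E := Real.exp_le_exp.2 hnT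
  have hGap : ∀ k : ℕ, 2 ≤ k → k < m → δ / 2 ≤ n / (T ^ 2 + 1 / 4) - Real.log k := fun k hk hkm ↦ by
    have hk0 : (0 : ℝ) < k := by exact_mod_cast (show 0 < k by omega)
    have hlogk : Real.log k ≤ Real.log (m - 1 : ℕ) :=
      Real.log_le_log hk0 (by exact_mod_cast (show k ≤ m - 1 by omega))
    have h1 := hgapT T hT0.le hT2
    have : Real.log (m - 1 : ℕ) = Real.log m - δ := by rw [hδ_def]; ring
    linarith
  have hgnr : ∀ k : ℕ, m < k → δ₁ ≤ Real.log k - n / T ^ 2 := fun k hk ↦ by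
    have hlogk : Real.log (m + 1 : ℕ) ≤ Real.log k :=
      Real.log_le_log (by exact_mod_cast (show 0 < m + 1 by omega)) (by exact_mod_cast (show m + 1 ≤ k by omega))
    rw [hc2] at hnT
    rw [hδ₁_def]
    linarith
  -- ### STEP 1: dominated convergence, `π liPrimeTail = Re Σ_k Λ(k) ∫ termIntegrand`
  set Fm : ℕ → ℝ → ℂ := fun m y ↦ LSeries.term f (liRightPt y) m * liCoSymWeight n (liRightPt y) with hFm
  have hFm_eq : ∀ m y, Fm m y = (Λ m : ℂ) * termIntegrand n m y := fun m y ↦ by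
    simp only [hFm, hf, term_eq, termIntegrand]; ring
  have hJ : HasSum (fun m ↦ ∫ y in Ioi T, Fm m y) (∫ y in Ioi T, primeIntegrand n y) := by
    refine hasSum_integral_of_dominated_convergence
      (fun m y ↦ ‖LSeries.term f (3 / 2 : ℂ) m‖ * (((n : ℝ) ^ 2 * E) * y ^ (-(2 : ℝ)))) ?_ ?_ ?_ ?_ ?_
    · intro m; exact ((continuous_term m).mul (continuous_coSymWeight n)).aestronglyMeasurable
    · intro m
      refine (ae_restrict_iff' measurableSet_Ioi).2 (Filter.Eventually.of_forall fun y hy ↦ ?_)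
      have hy0 : 0 < y := hT0.trans hy
      simp only [hFm]
      rw [norm_mul, norm_term_rightPt]
      refine mul_le_mul_of_nonneg_left ?_ (norm_nonneg _)
      have hdec := norm_liCoSymWeight_le_decay n (x := 3 / 2) ⟨by norm_num, le_rfl⟩ hy0
      have hw : ((3 / 2 : ℝ) : ℂ) + y * I = liRightPt y := by norm_num [liRightPt]
      rw [hw] at hdec
      refine hdec.trans ?_
      have hey : Real.exp (n / y ^ 2) ≤ E :=
        (Real.exp_le_exp.2 (div_le_div_of_nonneg_left (Nat.cast_nonneg n) (by positivity)
          (pow_le_pow_left₀ hT0.le hy.le 2))).trans hET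
      rw [Real.rpow_neg hy0.le, Real.rpow_two, div_eq_mul_inv]
      gcongr
    · exact Filter.Eventually.of_forall fun y ↦ hsum.mul_right _
    · have h := ((integrableOn_Ioi_rpow_of_lt (by norm_num : (-(2 : ℝ)) < -1) hT0).const_mul
        (S * ((n : ℝ) ^ 2 * E)))
      refine IntegrableOn.congr_fun h (fun y _ ↦ ?_) measurableSet_Ioi
      rw [tsum_mul_right, hSdef, mul_assoc]
    · refine Filter.Eventually.of_forall fun y ↦ ?_
      have hre : (1 : ℝ) < (liRightPt y).re := by rw [liRightPt_re]; norm_num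
      have hs : LSeriesSummable f (liRightPt y) := ArithmeticFunction.LSeriesSummable_vonMangoldt hre
      show HasSum (fun m ↦ LSeries.term f (liRightPt y) m * liCoSymWeight n (liRightPt y))
        (LSeries f (liRightPt y) * liCoSymWeight n (liRightPt y))
      exact hs.hasSum.mul_right _
  -- ### STEP 2: per-term errors
  set R := Finset.Ico 2 m with hR
  set K : ℝ := liBridgeTail n (Real.log m) T with hK
  set g : ℕ → ℝ := fun k ↦
    if k ∈ R then Real.pi * liCoffeyTerm k n else if k = m then (Λ m : ℝ) * ((m : ℝ) ^ (-(1 / 2 : ℝ)) * K) else 0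
    with hg
  have herr : ∀ k, ‖(∫ y in Ioi T, Fm k y).re - g k‖ ≤ ‖LSeries.term f (3 / 2 : ℂ) k‖ * B := by
    intro k
    have hint_eq : ∫ y in Ioi T, Fm k y = (Λ k : ℂ) * ∫ y in Ioi T, termIntegrand n k y := by
      rw [← MeasureTheory.integral_const_mul]
      exact integral_congr_ae (Filter.Eventually.of_forall (hFm_eq k))
    rcases lt_or_ge k 2 with hk | hk
    · -- `k = 0, 1`: everything vanishes
      have h0 := vonMangoldt_eq_zero_of_lt_two hk
      have hgk : g k = 0 := by
        simp only [hg, hR, Finset.mem_Ico]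
        rw [if_neg (by omega), if_neg (by omega)]
      rw [hint_eq, h0, hgk]; simp; positivity
    have hk0 : 0 < k := by omega
    have hnt : ‖LSeries.term f (3 / 2 : ℂ) k‖ = (Λ k : ℝ) * (k : ℝ) ^ (-(3 / 2 : ℝ)) := norm_term_three_halves hk0
    by_cases hΛ : (Λ k : ℝ) = 0
    · have hgk : g k = 0 := by
        simp only [hg]; split_ifs with h1 h2
        · rw [liCoffeyTerm, hΛ]; simp
        · subst h2; rw [hΛ]; simp
        · rfl
      rw [hint_eq, hgk, hΛ]; simp; positivity
    have hΛpos : 0 < (Λ k : ℝ) := lt_of_le_of_ne ArithmeticFunction.vonMangoldt_nonneg (Ne.symm hΛ)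
    have hre_eq : ((Λ k : ℂ) * ∫ y in Ioi T, termIntegrand n k y).re =
        (Λ k : ℝ) * (∫ y in Ioi T, termIntegrand n k y).re := by
      rw [Complex.re_ofReal_mul]
    have hkr : (0 : ℝ) < k := by exact_mod_cast hk0
    have hpow : (k : ℝ) ^ (-(1 / 2 : ℝ)) = (k : ℝ) ^ (-(3 / 2 : ℝ)) * k := by
      rw [show (-(1 / 2 : ℝ)) = -(3 / 2 : ℝ) + 1 by norm_num, Real.rpow_add hkr, Real.rpow_one]
    rcases lt_trichotomy k m with hkm | hkm | hkm
    · -- RELEASED `k < m`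
      have hkR : k ∈ R := by rw [hR, Finset.mem_Ico]; exact ⟨hk, hkm⟩
      have hgk : g k = Real.pi * liCoffeyTerm k n := by simp only [hg]; rw [if_pos hkR]
      have hrel := re_setIntegral_termIntegrand_released hn1 hk hT (half_pos hδ0) (hGap k hk hkm)
      have hkm' : (k : ℝ) ≤ m := by exact_mod_cast hkm.le
      have hlogk : Real.log 2 ≤ Real.log k := Real.log_le_log (by norm_num) (by exact_mod_cast hk)
      have hfac : 4 / Real.log k + 2 / (δ / 2) + 3 + Real.exp (n / T ^ 2) ≤ 4 / Real.log 2 + 2 / (δ / 2) + 3 + E := by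
        gcongr
      have hcoffey : (Λ k : ℝ) * (Real.pi / k * liLaguerreOne n (Real.log k)) = Real.pi * liCoffeyTerm k n := by
        rw [liCoffeyTerm]; ring
      rw [hint_eq, hre_eq, hgk, ← hcoffey, ← mul_sub, norm_mul, Real.norm_eq_abs, abs_of_pos hΛpos, hnt, mul_assoc]
      refine mul_le_mul_of_nonneg_left ?_ hΛpos.le
      rw [Real.norm_eq_abs]
      refine (hrel.trans (mul_le_mul_of_nonneg_left hfac (by positivity))).trans ?_
      rw [hpow, mul_assoc]
      refine mul_le_mul_of_nonneg_left ?_ (by positivity)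
      calc (k : ℝ) * (4 / Real.log 2 + 2 / (δ / 2) + 3 + E) ≤ m * (4 / Real.log 2 + 2 / (δ / 2) + 3 + E) := by
            gcongr
        _ = Brel := rfl
        _ ≤ B := by rw [hB]; linarith
    · -- RESONANT `k = m`
      subst hkm
      have hkR : k ∉ R := by rw [hR, Finset.mem_Ico]; omega
      have hgk : g k = (Λ k : ℝ) * ((k : ℝ) ^ (-(1 / 2 : ℝ)) * K) := by
        simp only [hg]; rw [if_neg hkR]; simp
      have hres := re_setIntegral_termIntegrand_resonant n hk0 hT
      have hfac : 3 + Real.exp (n / T ^ 2) ≤ 3 + E := by gcongr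
      rw [hint_eq, hre_eq, hgk, ← mul_sub, norm_mul, Real.norm_eq_abs, abs_of_pos hΛpos, hnt, mul_assoc]
      refine mul_le_mul_of_nonneg_left ?_ hΛpos.le
      rw [Real.norm_eq_abs]
      refine (hres.trans (mul_le_mul_of_nonneg_left hfac (by positivity))).trans ?_
      rw [hpow, mul_assoc]
      refine mul_le_mul_of_nonneg_left ?_ (by positivity)
      calc (k : ℝ) * (3 + E) = Bres := rfl
        _ ≤ B := by rw [hB]; linarith
    · -- NOT RELEASED `k > m`
      have hkR : k ∉ R := by rw [hR, Finset.mem_Ico]; omega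
      have hgk : g k = 0 := by simp only [hg]; rw [if_neg hkR, if_neg (by omega)]
      have hnr := norm_setIntegral_termIntegrand_le (n := n) hk hT hδ₁0 (hgnr k hkm)
      have hlogk : Real.log 2 ≤ Real.log k := Real.log_le_log (by norm_num) (by exact_mod_cast hk)
      have hfac : 6 / Real.log k + 3 * n / (2 * T ^ 2 * Real.log k ^ 2) +
          Real.exp (n / T ^ 2) * (2 / δ₁ + 3 * n / (2 * T ^ 2 * δ₁ ^ 2)) ≤ Bnr := by
        have hlk0 : 0 < Real.log k := hl2.trans_le hlogk
        have hTne : T ≠ 0 := hT0.ne'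
        have hlkne : Real.log k ≠ 0 := hlk0.ne'
        have hcne : c ≠ 0 := hc.ne'
        have hl2ne : Real.log 2 ≠ 0 := hl2.ne'
        have hδ₁ne : δ₁ ≠ 0 := hδ₁0.ne'
        have hb : 1 / Real.log k ^ 2 ≤ 1 / Real.log 2 ^ 2 :=
          one_div_le_one_div_of_le (by positivity) (pow_le_pow_left₀ hl2.le hlogk 2)
        have h1 : 3 * (n : ℝ) / (2 * T ^ 2 * Real.log k ^ 2) ≤ 3 / (2 * c ^ 2 * Real.log 2 ^ 2) := by
          calc 3 * (n : ℝ) / (2 * T ^ 2 * Real.log k ^ 2) = 3 / 2 * (n / T ^ 2) * (1 / Real.log k ^ 2) := by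
                field_simp
            _ ≤ 3 / 2 * (1 / c ^ 2) * (1 / Real.log 2 ^ 2) := by gcongr
            _ = 3 / (2 * c ^ 2 * Real.log 2 ^ 2) := by field_simp
        have h2 : 3 * (n : ℝ) / (2 * T ^ 2 * δ₁ ^ 2) ≤ 3 / (2 * c ^ 2 * δ₁ ^ 2) := by
          calc 3 * (n : ℝ) / (2 * T ^ 2 * δ₁ ^ 2) = 3 / 2 * (n / T ^ 2) * (1 / δ₁ ^ 2) := by
                field_simp
            _ ≤ 3 / 2 * (1 / c ^ 2) * (1 / δ₁ ^ 2) := by gcongr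
            _ = 3 / (2 * c ^ 2 * δ₁ ^ 2) := by field_simp
        rw [hBnr]
        gcongr
      rw [hint_eq, hre_eq, hgk, sub_zero, norm_mul, Real.norm_eq_abs, abs_of_pos hΛpos, hnt, mul_assoc]
      refine mul_le_mul_of_nonneg_left ?_ hΛpos.le
      rw [Real.norm_eq_abs]
      refine ((Complex.abs_re_le_norm _).trans (hnr.trans (mul_le_mul_of_nonneg_left hfac (by positivity)))).trans ?_
      refine mul_le_mul_of_nonneg_left ?_ (by positivity)
      rw [hB]; linarith
  -- ### STEP 3: sum the errors
  set Main : ℝ := Real.pi * (∑ k ∈ R, liCoffeyTerm k n) + (Λ m : ℝ) * ((m : ℝ) ^ (-(1 / 2 : ℝ)) * K) with hMain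
  have hgsum : HasSum g Main := by
    have hmR : m ∉ R := by rw [hR, Finset.mem_Ico]; omega
    have h : HasSum g (∑ k ∈ Finset.Ico 2 (m + 1), g k) :=
      hasSum_sum_of_ne_finset_zero (fun k hk ↦ by
        rw [Finset.mem_Ico] at hk
        have hkR : k ∉ R := by rw [hR, Finset.mem_Ico]; omega
        simp only [hg]; rw [if_neg hkR, if_neg (by omega)])
    have hs : ∑ k ∈ Finset.Ico 2 (m + 1), g k = Main := by
      rw [Finset.sum_Ico_succ_top hm, hMain, Finset.mul_sum]
      congr 1
      · exact Finset.sum_congr rfl fun k hk ↦ by simp only [hg]; rw [if_pos hk]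
      · simp only [hg]; rw [if_neg hmR]; simp
    rwa [hs] at h
  have hJre : HasSum (fun k ↦ (∫ y in Ioi T, Fm k y).re) ((∫ y in Ioi T, primeIntegrand n y).re) := by
    have := Complex.reCLM.hasSum hJ
    simpa using this
  have hdiff : HasSum (fun k ↦ (∫ y in Ioi T, Fm k y).re - g k) ((∫ y in Ioi T, primeIntegrand n y).re - Main) :=
    hJre.sub hgsum
  have hnorm : ‖(∫ y in Ioi T, primeIntegrand n y).re - Main‖ ≤ S * B := by
    rw [← hdiff.tsum_eq]
    have := tsum_of_norm_bounded (hsum.mul_right B).hasSum herr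
    rwa [tsum_mul_right] at this
  -- ### STEP 4: back to `liPrimeTail`
  have hπ : Real.pi ≠ 0 := Real.pi_pos.ne'
  have hfinal : liPrimeTail n T - (∑ k ∈ R, liCoffeyTerm k n)
        - (Λ m : ℝ) / Real.pi * (m : ℝ) ^ (-(1 / 2 : ℝ)) * K
      = 1 / Real.pi * ((∫ y in Ioi T, primeIntegrand n y).re - Main) := by
    rw [liPrimeTail_eq, hMain]
    field_simp
    ring
  rw [hfinal, abs_mul, abs_of_pos (by positivity : (0 : ℝ) < 1 / Real.pi)]
  have hlogn : Real.log 2 ≤ Real.log n := Real.log_le_log (by norm_num) (by exact_mod_cast hn2)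
  have hS0 : 0 ≤ S := tsum_nonneg fun _ ↦ norm_nonneg _
  have hSB : 0 ≤ 1 / Real.pi * (S * B) / Real.log 2 := by positivity
  calc 1 / Real.pi * |(∫ y in Ioi T, primeIntegrand n y).re - Main|
      ≤ 1 / Real.pi * (S * B) := by
        refine mul_le_mul_of_nonneg_left ?_ (by positivity)
        rw [← Real.norm_eq_abs]; exact hnorm
    _ = 1 / Real.pi * (S * B) / Real.log 2 * Real.log 2 := by field_simp
    _ ≤ 1 / Real.pi * (S * B) / Real.log 2 * Real.log n := by gcongr

end PrimeTailResonant

end Summit.RiemannHypothesis.RiemannHypothesis.Theorems.LiTheory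

end
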